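/-
Copyright (c) 2026 the pub-hodgecm-mathlib formalisation cell (harness21).  Prover seat hodgecm-mathlib-A-p03 (g24); LEAD F0P3a-plan (g9) WORD T8-41 «(F4)–(F8) PEN 1»;
LAYER C exponent dictionary for the (F12) value stubs (p04 (g12) ED. 1.5 `stub_splitGValue2∕3∕4`), 2026-09-01.
-/
import Literature.NumberTheory.Rogawski1990.UnitOrbitalIntegralInertCountJPosTorus        -- ★ `v_eq_of_v_sub_lt_v_add`, frame
import Literature.NumberTheory.Rogawski1990.UnitOrbitalIntegralInertSumsThetaZero       -- ★ `phiOne_of_le`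
import HarnessLib

/-!
# LAYER C exponent dictionary: `N₊ = ord(x + z − 2y)` exists for a regular norm-one triple and `phiOne q N₊ P = phiOne q Q₁ P`

Topic `NumberTheory/Rogawski1990` (road «D-N7-inert», LAYER C glue); namespace `Literature.NumberTheory.Automorphic.UnitaryGroup`.  THEOREMS ONLY; kernel lane.

★ `natCard_fixedPoints_unitaryInt_flickerTorus_eq_phiOne_of_bridge` (p841664) outputs `phiOne q N₊ P` with `P = ord(x − z)` (the corner pair) and `N₊ = ord(x + z − 2y)`
(`y` the middle eigenvalue), while the (F12) value stubs (p04's ED. 1.5) print `phiOne q Q₁ P` with `Q₁ = ord(x − y)`.  For norm-one `x, y, z` with `x ≠ z`: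
(i) `x + z ≠ 2y` (else `σ` gives `y² = xz`, so `(x−z)² = 0`) — hence `N₊` exists; (ii) by ultrametricity the two smallest of `Q₁ = ord(x−y)`, `Q₂ = ord(z−y)`,
`P = ord(x−z)` coincide and `N₊ = min(Q₁,Q₂)` unless `Q₁ = Q₂ = P` (then `N₊ ≥ P`); in every case `phiOne q N₊ P = phiOne q Q₁ P` (★ `phiOne_of_le`: for
`P ≤ N₁` the value depends on `P` only).  Head: **`exists_exponent_phiOne_eq`** — serves X₂ (`(x,y,z) = (α,u,γ)`), X₃ (`(α,γ,u)`), X₄ (`(u,α,γ)`).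
HONEST LABEL: HC_CM is proved only modulo the printed citations until rung 0 closes.

## References
* [Flicker1998UnitaryFL] Y. Z. Flicker, *Elementary proof of the fundamental lemma for a unitary group*, Canad. J. Math. 50 (1998), 74–98: §4 p. 85 (`N₁, N₂, N, N₊`),
  Prop. 11 p. 87, Props 12–13 pp. 89–94.
-/

set_option autoImplicit false

open scoped MatrixGroups WithZero Valued

namespace Literature.NumberTheory.Automorphic

namespace UnitaryGroup

open Literature.NumberTheory.Automorphic.HermitianLattice (LocalConjDatum)
open Literature.NumberTheory.Rogawski1990.Flicker1998 (phiOne phiOne_of_le)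

variable {K : Type*} [Field K] [Valued K ℤᵐ⁰] {ϖ : K} (σ : K →+* K)

omit [Valued K ℤᵐ⁰] in
/-- **Regular norm-one triples do not cancel**: `σx·x = σy·y = σz·z = 1`, `x ≠ z` ⇒ `x + z − 2y ≠ 0` (else `σ` of the relation gives `y² = xz` and `(x − z)² = 0`).
[cite: Flicker1998UnitaryFL, §4 p. 85] -/
theorem add_sub_two_mul_ne_zero (h2 : (2 : K) ≠ 0) {x y z : K} (hx : σ x * x = 1) (hy : σ y * y = 1) (hz : σ z * z = 1) (hxz : x ≠ z) :
    x + z - 2 * y ≠ 0 := by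
  intro h
  have hx0 : x ≠ 0 := fun h0 => by rw [h0, mul_zero] at hx; exact zero_ne_one hx
  have hy0 : y ≠ 0 := fun h0 => by rw [h0, mul_zero] at hy; exact zero_ne_one hy
  have hz0 : z ≠ 0 := fun h0 => by rw [h0, mul_zero] at hz; exact zero_ne_one hz
  have hσx : σ x = x⁻¹ := eq_inv_of_mul_eq_one_left hx
  have hσy : σ y = y⁻¹ := eq_inv_of_mul_eq_one_left hy
  have hσz : σ z = z⁻¹ := eq_inv_of_mul_eq_one_left hz
  have h1 : x + z = 2 * y := sub_eq_zero.1 h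
  have h2' : x⁻¹ + z⁻¹ = 2 * y⁻¹ := by
    have := congrArg σ h1; rw [map_add, map_mul, map_ofNat, hσx, hσy, hσz] at this; exact this
  have h3 : (x + z) * y = 2 * (x * z) := by
    field_simp at h2'; linear_combination h2'
  have hy' : y = (x + z) / 2 := by field_simp; linear_combination (-1 : K) * h1
  have h4 : (x - z) ^ 2 = 0 := by
    rw [hy'] at h3; field_simp at h3; linear_combination h3
  exact hxz (sub_eq_zero.1 (pow_eq_zero_iff two_ne_zero |>.1 h4))

/-- **The exponent `N₊` and the value dictionary**: for norm-one `x, y, z` with `x ≠ z`, `|x − z| = |ϖ^P|`, `|x − y| = |ϖ^{Q₁}|`, `|z − y| = |ϖ^{Q₂}|` there is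
`N₊` with `|x + z − 2y| = |ϖ^{N₊}|`, and `phiOne q N₊ P = phiOne q Q₁ P` (the two smallest of `Q₁, Q₂, P` coincide; `phiOne q · P` is constant on `[P, ∞)`).
[cite: Flicker1998UnitaryFL, §4 p. 85, Prop. 11 p. 87] -/
theorem exists_exponent_phiOne_eq (hd : LocalConjDatum σ ϖ) {x y z : K} (hx : σ x * x = 1) (hy : σ y * y = 1) (hz : σ z * z = 1) (hxz : x ≠ z)
    {P Q₁ Q₂ : ℕ} (hP : Valued.v (x - z) = Valued.v (ϖ ^ P)) (hQ₁ : Valued.v (x - y) = Valued.v (ϖ ^ Q₁)) (hQ₂ : Valued.v (z - y) = Valued.v (ϖ ^ Q₂)) :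
    ∃ Np : ℕ, Valued.v (x + z - 2 * y) = Valued.v (ϖ ^ Np) ∧ ∀ q : ℕ, phiOne q Np P = phiOne q Q₁ P := by
  have h2v : Valued.v (2 : K) = 1 := hd.v2
  have h2 : (2 : K) ≠ 0 := fun h => by rw [h, map_zero] at h2v; exact zero_ne_one h2v
  have hne : x + z - 2 * y ≠ 0 := add_sub_two_mul_ne_zero σ h2 hx hy hz hxz
  -- the valuation of a non-zero element of valuation ≤ 1 is `|ϖ^k|`
  have hle : Valued.v (x + z - 2 * y) ≤ 1 := by
    have hvx : Valued.v x = 1 := by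
      have h := congrArg Valued.v hx; rw [map_mul, hd.vσ, map_one] at h
      exact Literature.NumberTheory.QuadraticForms.OMeara65.WithZeroMulInt.eq_one_of_mul_self h
    have hvy : Valued.v y = 1 := by
      have h := congrArg Valued.v hy; rw [map_mul, hd.vσ, map_one] at h
      exact Literature.NumberTheory.QuadraticForms.OMeara65.WithZeroMulInt.eq_one_of_mul_self h
    have hvz : Valued.v z = 1 := by
      have h := congrArg Valued.v hz; rw [map_mul, hd.vσ, map_one] at h
      exact Literature.NumberTheory.QuadraticForms.OMeara65.WithZeroMulInt.eq_one_of_mul_self h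
    refine le_trans (Valuation.map_sub _ _ _) (max_le (le_trans (Valuation.map_add _ _ _) (max_le hvx.le hvz.le)) ?_)
    rw [map_mul, h2v, one_mul]; exact hvy.le
  obtain ⟨Np, hNp⟩ : ∃ Np : ℕ, Valued.v (x + z - 2 * y) = Valued.v (ϖ ^ Np) := by
    have hv0 : Valued.v (x + z - 2 * y) ≠ 0 := (Valuation.ne_zero_iff _).2 hne
    obtain ⟨k, hk⟩ : ∃ k : ℤ, Valued.v (x + z - 2 * y) = WithZero.exp k := ⟨_, (WithZero.exp_log hv0).symm⟩
    have hk0 : k ≤ 0 := by rw [hk, ← WithZero.exp_zero, WithZero.exp_le_exp] at hle; exact hle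
    refine ⟨k.natAbs, ?_⟩
    rw [hk, hd.v_pow]; congr 1; omega
  refine ⟨Np, hNp, fun q => ?_⟩
  -- `x + z − 2y = (x − y) + (z − y)`, `x − z = (x − y) − (z − y)`
  have es : x + z - 2 * y = (x - y) + (z - y) := by ring
  have ed : x - z = (x - y) - (z - y) := by ring
  rcases lt_trichotomy Q₁ Q₂ with hlt | heq | hgt
  · -- `Q₁ < Q₂`: `N₊ = Q₁`
    have : Valued.v (x + z - 2 * y) = Valued.v (ϖ ^ Q₁) := by
      rw [es, Valuation.map_add_eq_of_lt_left _ (by rw [hQ₁, hQ₂, hd.v_pow, hd.v_pow, WithZero.exp_lt_exp]; omega), hQ₁]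
    rw [this, hd.v_pow, hd.v_pow, WithZero.exp_inj] at hNp
    rw [show Np = Q₁ by omega]
  · -- `Q₁ = Q₂`: either `< P` (then `N₊ = Q₁`) or `= P` (then `N₊ ≥ P` and both values are the `P ≤ ·` branch) — `Q₁ = Q₂ > P` is impossible
    subst heq
    have hPle : Q₁ ≤ P := by
      have h := Valuation.map_sub (Valued.v) (x - y) (z - y)
      rw [← ed, hP, hQ₁, hQ₂, max_self, hd.v_pow, hd.v_pow, WithZero.exp_le_exp] at h; omega
    rcases hPle.lt_or_eq with hlt' | heq'
    · have hsum : Valued.v (x + z - 2 * y) = Valued.v (ϖ ^ Q₁) := by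
        -- `2(x−y) = (x+z−2y) + (x−z)`: if `|x+z−2y| < |ϖ^{Q₁}|` then `|x−y| < |ϖ^{Q₁}|`, absurd
        by_contra hne'
        have hlt2 : Valued.v (x + z - 2 * y) < Valued.v (ϖ ^ Q₁) := by
          refine lt_of_le_of_ne ?_ hne'
          rw [es]; refine le_trans (Valuation.map_add _ _ _) (max_le hQ₁.le hQ₂.le)
        have hP' : Valued.v (x - z) < Valued.v (ϖ ^ Q₁) := by rw [hP, hd.v_pow, hd.v_pow, WithZero.exp_lt_exp]; omega
        have h2xy : Valued.v (2 * (x - y)) < Valued.v (ϖ ^ Q₁) := by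
          rw [show 2 * (x - y) = (x + z - 2 * y) + (x - z) by ring]
          exact lt_of_le_of_lt (Valuation.map_add _ _ _) (max_lt hlt2 hP')
        rw [map_mul, h2v, one_mul, hQ₁] at h2xy
        exact lt_irrefl _ h2xy
      rw [hsum, hd.v_pow, hd.v_pow, WithZero.exp_inj] at hNp
      rw [show Np = Q₁ by omega]
    · -- `Q₁ = Q₂ = P ≤ N₊`
      subst heq'
      have hNpge : Q₁ ≤ Np := by
        have h : Valued.v (x + z - 2 * y) ≤ Valued.v (ϖ ^ Q₁) := by
          rw [es]; exact le_trans (Valuation.map_add _ _ _) (max_le hQ₁.le hQ₂.le)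
        rw [hNp, hd.v_pow, hd.v_pow, WithZero.exp_le_exp] at h; omega
      rw [phiOne_of_le q hNpge, phiOne_of_le q le_rfl]
  · -- `Q₂ < Q₁`: `N₊ = Q₂ = P < Q₁`, both values are the `P ≤ ·` branch
    have hsum : Valued.v (x + z - 2 * y) = Valued.v (ϖ ^ Q₂) := by
      rw [es, Valuation.map_add_eq_of_lt_right _ (by rw [hQ₁, hQ₂, hd.v_pow, hd.v_pow, WithZero.exp_lt_exp]; omega), hQ₂]
    have hdiff : Valued.v (x - z) = Valued.v (ϖ ^ Q₂) := by
      rw [show x - z = (x - y) + (-(z - y)) by ring,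
        Valuation.map_add_eq_of_lt_right _ (by rw [Valuation.map_neg, hQ₁, hQ₂, hd.v_pow, hd.v_pow, WithZero.exp_lt_exp]; omega),
        Valuation.map_neg, hQ₂]
    rw [hsum, hd.v_pow, hd.v_pow, WithZero.exp_inj] at hNp
    rw [hdiff, hd.v_pow, hd.v_pow, WithZero.exp_inj] at hP
    have hNpP : Np = P := by omega
    rw [hNpP, phiOne_of_le q le_rfl, phiOne_of_le q (by omega : P ≤ Q₁)]

end UnitaryGroup

end Literature.NumberTheory.Automorphic
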